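import Literature.AlgebraicGeometry.Resolution.HenselRootsAmbient
import Literature.AlgebraicGeometry.Resolution.HenselizedFunctionFieldsImmediate
import HarnessLib

/-!
# Passing to the residue field of a coarsening: `(FP₁ | KP₁, P̄)` inside `ΩP₁`

Topic: `Literature/AlgebraicGeometry/Resolution` (valued function fields). Glue for the proof of
F.-V. Kuhlmann, *Elimination of ramification II: Henselian rationality*, Israel J. Math. 234
(2019) = arXiv:1701.05508, **Prop. 5.6** (`Kuhlmann2019HenselianRationalityFiniteRankProofs.lean`),
which decomposes the place `P` of an immediate function field `(F|K, P)` of finite rank as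
`P = P₁P₂P₃` and works with the residue fields `FP₁ ⊇ KP₁` valued by the induced place:

> Since `(F|K,P)` is immediate, it follows from Lemma 5.5 that `v_{P₁}F = v_{P₁}K`,
> `v_{P₂}(FP₁) = v_{P₂}(KP₁)` … This yields that also `(FP₁|KP₁, P₂)` is immediate.

with Lemma 5.5 (a): "[`(L,P)` with `P = Q₁Q₂`:] `v_P L` … `v_{Q₁}L` … and `(LQ₁, Q₂)`" (the
standard dévissage of a composite place, Zariski–Samuel II, Ch. VI §10). In the ambient
rendering (one valued field `(Ω, V)`, subfields `K ≤ F ≤ Ω`): a coarsening is an overring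
`W ≥ V`; the residue field `ΩW = ResidueField W` carries the residue valuation ring
`V/𝔪_W = residueValuationSubring V W` (`CompositeValuations.lean`), and `KW = resField W K`,
`FW = resField W F` are subfields of `ΩW`. This file PROVES the bookkeeping the assembly needs:

* `IsImmediateOver.resField_of_le` — **Lemma 5.5 (a) for immediate extensions**: if `(F|K, V)` is
  immediate then so is `(FW | KW, V/𝔪_W)`.
* `isRankOne_resField_of_minimal` — if `W ∩ K` is the minimal proper overring of `V ∩ K`, then
  `(KW, V/𝔪_W)` has rank one (`IsRankOne`: the overrings of `V/𝔪_W ∩ KW` correspond to the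
  overrings of `V ∩ K` inside `W ∩ K`).
* overrings of finite-rank valuation rings: `exists_minimal_proper_overring` (a valuation ring
  with finitely many overrings which is not of rank one has a minimal proper overring `≠` the
  field), `finite_overrings_of_le`, `card_overrings_lt_of_ne` (an overring has fewer
  overrings — the induction on the rank).
* finite subextensions inside `Ω`: `fgOver_of_relfinrank_pos`, `finiteOver_of_relfinrank_pos`
  (`[B : A] < ∞ ⇒ B|A` finitely generated / finite in the sense of `ValuedFunctionFields.lean`).

Everything is [folklore] and PROVED.

## Sources

* F.-V. Kuhlmann, Israel J. Math. 234 (2019) = arXiv:1701.05508: Lemma 5.5 (a) and the proof of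
  Prop. 5.6 (p. 13).
* O. Zariski, P. Samuel, *Commutative Algebra* II (1960), Ch. VI §10 (composite valuations).
-/

noncomputable section

open IsLocalRing

namespace Literature.AlgebraicGeometry.Resolution

universe u

/-! ### Overrings of a valuation ring with finitely many overrings -/

section Overrings

variable {K : Type*} [Field K]

/-- Overrings of an overring `R ≥ O` are overrings of `O`; in particular finitely many if `O` has
finitely many. [folklore] -/
theorem finite_overrings_of_le (O R : ValuationSubring K) (hOR : O ≤ R)
    [Finite {S : ValuationSubring K // O ≤ S}] : Finite {S : ValuationSubring K // R ≤ S} :=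
  Finite.of_injective (fun S : {S : ValuationSubring K // R ≤ S} =>
      (⟨S.1, hOR.trans S.2⟩ : {S : ValuationSubring K // O ≤ S}))
    fun S T h => by
      apply Subtype.ext
      have := congrArg Subtype.val h
      exact this

/-- **A proper overring has fewer overrings** (the rank drops under a proper coarsening).
[folklore] -/
theorem card_overrings_lt_of_ne (O R : ValuationSubring K) (hOR : O ≤ R) (hne : R ≠ O)
    [Finite {S : ValuationSubring K // O ≤ S}] :
    Nat.card {S : ValuationSubring K // R ≤ S} < Nat.card {S : ValuationSubring K // O ≤ S} := by
  let ι : {S : ValuationSubring K // R ≤ S} → {S : ValuationSubring K // O ≤ S} :=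
    fun S => ⟨S.1, hOR.trans S.2⟩
  have hι : Function.Injective ι := fun S T h => by
    apply Subtype.ext
    have := congrArg Subtype.val h
    exact this
  refine lt_of_le_of_ne (Nat.card_le_card_of_injective ι hι) fun heq => ?_
  have hbij := hι.bijective_of_nat_card_le heq.ge
  obtain ⟨S, hS⟩ := hbij.2 ⟨O, le_rfl⟩
  have hSO : S.1 = O := congrArg Subtype.val hS
  exact hne (le_antisymm (hSO ▸ S.2) hOR)

/-- **A minimal proper overring.** If the valuation ring `O` has finitely many overrings and some
overring `S` with `O ≠ S ≠ K` (i.e. `O` is neither `K` nor of rank one), then there is an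
overring `R` with `O ≠ R ≠ K` such that the only overrings of `O` inside `R` are `O` and `R`
(the overrings are totally ordered; take `R` minimal among the proper ones `≠ K`). [folklore] -/
theorem exists_minimal_proper_overring (O : ValuationSubring K)
    [Finite {S : ValuationSubring K // O ≤ S}]
    (h : ∃ S : ValuationSubring K, O ≤ S ∧ S ≠ O ∧ S ≠ ⊤) :
    ∃ R : ValuationSubring K, O ≤ R ∧ R ≠ O ∧ R ≠ ⊤ ∧
      ∀ S : ValuationSubring K, O ≤ S → S ≤ R → S = O ∨ S = R := by
  set A : Set {S : ValuationSubring K // O ≤ S} := {S | S.1 ≠ O ∧ S.1 ≠ ⊤} with hA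
  have hAne : A.Nonempty := by
    obtain ⟨S, hOS, h1, h2⟩ := h
    exact ⟨⟨S, hOS⟩, h1, h2⟩
  obtain ⟨R, ⟨hR1, hR2⟩, hmin⟩ := (Set.toFinite A).exists_minimal hAne
  refine ⟨R.1, R.2, hR1, hR2, fun S hOS hSR => ?_⟩
  by_cases hSO : S = O
  · exact Or.inl hSO
  · right
    have hStop : S ≠ ⊤ := fun hS => hR2 (top_le_iff.mp (hS ▸ hSR))
    have hSA : (⟨S, hOS⟩ : {S : ValuationSubring K // O ≤ S}) ∈ A := ⟨hSO, hStop⟩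
    have hle : (⟨S, hOS⟩ : {S : ValuationSubring K // O ≤ S}) ≤ R := hSR
    exact congrArg Subtype.val (le_antisymm hle (hmin hSA hle))

end Overrings

/-! ### Finite subextensions inside `Ω` -/

section Finite

variable {Ω : Type u} [Field Ω]

/-- **`[B : A] < ∞ ⇒ B|A` is finitely generated**: `B = A(s)` for a finite `A`-spanning set `s`
of `B`. [folklore] -/
theorem fgOver_of_relfinrank_pos {A B : Subfield Ω} (h : A ≤ B) (hpos : 0 < Subfield.relfinrank A B) :
    FGOver A B := by
  classical
  set B' : IntermediateField A Ω := Subfield.extendScalars h with hB'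
  haveI : FiniteDimensional A B' := by
    rw [Subfield.relfinrank_eq_finrank_of_le h] at hpos
    exact Module.finite_of_finrank_pos hpos
  obtain ⟨t, ht⟩ := Module.finite_def.mp (inferInstance : Module.Finite A B')
  refine ⟨t.image (fun y : B' => (y : Ω)), le_antisymm ?_ ?_⟩
  · refine Subfield.closure_le.mpr (Set.union_subset h ?_)
    intro w hw
    obtain ⟨y, -, rfl⟩ := Finset.mem_image.mp (Finset.mem_coe.mp hw)
    exact y.2
  · intro z hz
    have hz' : (⟨z, hz⟩ : B') ∈ Submodule.span A (t : Set B') := by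
      rw [ht]
      exact Submodule.mem_top
    set C : Subfield Ω := Subfield.closure ((A : Set Ω) ∪ ↑(t.image fun y : B' => (y : Ω))) with hC
    suffices hall : ∀ y ∈ Submodule.span A (t : Set B'), ((y : B') : Ω) ∈ C from hall _ hz'
    intro y hy
    refine Submodule.span_induction (p := fun y _ => ((y : B') : Ω) ∈ C) ?_ ?_ ?_ ?_ hy
    · intro w hw
      exact Subfield.subset_closure (Or.inr (Finset.mem_coe.mpr
        (Finset.mem_image.mpr ⟨w, hw, rfl⟩)))
    · exact C.zero_mem
    · intro w w' _ _ hw hw'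
      exact C.add_mem hw hw'
    · intro c w _ hw
      have : (((c • w : B') : Ω)) = (c : Ω) * (w : Ω) := rfl
      rw [this]
      exact C.mul_mem (Subfield.subset_closure (Or.inl c.2)) hw

/-- **`[B : A] < ∞ ⇒ B|A` is finite** (finitely generated by algebraic elements). [folklore] -/
theorem finiteOver_of_relfinrank_pos {A B : Subfield Ω} (h : A ≤ B)
    (hpos : 0 < Subfield.relfinrank A B) : FiniteOver A B := by
  obtain ⟨s, hs⟩ := fgOver_of_relfinrank_pos h hpos
  refine ⟨s, fun y hy => isAlgebraic_of_relfinrank_pos h hpos ?_, hs⟩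
  rw [← hs]
  exact Subfield.subset_closure (Or.inr (Finset.mem_coe.mpr hy))

end Finite

/-! ### The residue fields of `K ≤ F` under a coarsening `W ≥ V` -/

section Residue

variable {Ω : Type u} [Field Ω] {V W : ValuationSubring Ω} (hVW : V ≤ W)

include hVW

/-- **Lemma 5.5 (a) for an immediate extension**: if `(F|K, V)` is immediate (every value and
every residue of `F` is one of `K`), then so is `(FW | KW, V/𝔪_W)` inside the residue field
`ΩW` of the coarsening `W ≥ V` ("`v_{P₂}(FP₁) = v_{P₂}(KP₁)` … `(FP₁|KP₁, P₂)` is immediate",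
proof of Prop. 5.6). PROVED: a unit `a` of `W ∩ F` is `b·u` with `b ∈ K`, `u` a unit of `V`,
whose `W`-residue is a unit of `V/𝔪_W`; an element of `V ∩ F` is `b + m` with `b ∈ V ∩ K`,
`m ∈ 𝔪_V`, whose `W`-residue lies in the maximal ideal of `V/𝔪_W`.
[cite: Kuhlmann2019, Lemma 5.5 (a) and Prop. 5.6 (proof)] -/
theorem IsImmediateOver.resField_of_le {K F : Subfield Ω} (h : IsImmediateOver V K F) :
    IsImmediateOver (residueValuationSubring V W hVW) (resField W K) (resField W F) := by
  set V₁ := residueValuationSubring V W hVW with hV₁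
  constructor
  · intro abar habar ha0
    obtain ⟨a, haF, rfl⟩ := (mem_resField_iff W F abar).mp habar
    have ha0' : (a : Ω) ≠ 0 := fun h0 => ha0 (by
      have : a = 0 := Subtype.ext h0
      rw [this, map_zero])
    obtain ⟨b, hbK, hab⟩ := h.1 a haF ha0'
    have hb0 : b ≠ 0 := by
      rintro rfl
      rw [map_zero, map_eq_zero] at hab
      exact ha0' hab
    -- `u = a / b` is a unit of `V`
    have hu : V.valuation ((a : Ω) / b) = 1 := by
      rw [map_div₀, hab, div_self ((map_ne_zero _).mpr hb0)]
    obtain ⟨huV, huiV⟩ := (valuation_eq_one_iff_mem_and_inv_mem V (div_ne_zero ha0' hb0)).mp hu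
    have hbW : b ∈ W := by
      have : b = (a : Ω) * ((a : Ω) / b)⁻¹ := by field_simp
      rw [this]
      exact W.mul_mem _ _ a.2 (hVW huiV)
    set b' : W := ⟨b, hbW⟩ with hb'
    set u' : W := ⟨(a : Ω) / b, hVW huV⟩ with hu'
    have hau : a = u' * b' := Subtype.ext (by
      change (a : Ω) = (a : Ω) / b * b
      rw [div_mul_cancel₀ _ hb0])
    refine ⟨residue W b', residue_mem_resField W b' hbK, ?_⟩
    rw [hau, map_mul, map_mul, (valuation_residue_eq_one_iff hVW u').mpr hu, one_mul]
  · intro r hr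
    obtain ⟨abar, habarF, rfl⟩ := (mem_resField_iff V₁ (resField W F) r).mp hr
    obtain ⟨a, haF, ha⟩ := (mem_resField_iff W F _).mp habarF
    have haV : (a : Ω) ∈ V := (residue_mem_residueValuationSubring_iff V W hVW a).mp (ha ▸ abar.2)
    obtain ⟨b, hbK, hb⟩ :=
      (mem_resField_iff V K _).mp (h.2 (residue_mem_resField V ⟨(a : Ω), haV⟩ haF))
    have hsmall : V.valuation ((a : Ω) - b) < 1 := by
      have := (residue_eq_residue_iff V b ⟨(a : Ω), haV⟩).mp hb
      rw [Valuation.map_sub_swap] at this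
      exact this
    set b' : W := ⟨b, hVW b.2⟩ with hb'
    have hb'V₁ : residue W b' ∈ V₁ := (residue_mem_residueValuationSubring_iff V W hVW b').mpr b.2
    have heq : residue V₁ abar = residue V₁ ⟨residue W b', hb'V₁⟩ := by
      rw [residue_eq_residue_iff]
      change V₁.valuation ((abar : ResidueField W) - residue W b') < 1
      rw [← ha, ← map_sub, valuation_residue_lt_one_iff hVW]
      exact hsmall
    rw [heq]
    exact residue_mem_resField V₁ ⟨residue W b', hb'V₁⟩ (residue_mem_resField W b' hbK)

/-- **Rank one of `(KW, V/𝔪_W)` for the minimal proper coarsening.** If `V ∩ K ≠ W ∩ K` and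
the only overrings of `V ∩ K` inside `W ∩ K` are these two, then the valuation ring
`V/𝔪_W ∩ KW` of the residue field `KW ⊆ ΩW` is `≠ KW` and its only overrings are itself and
`KW` (`IsRankOne`): an overring `S₁` extends to an overring of `V/𝔪_W` in `ΩW` (`comapHull`),
pulls back to an overring of `V` inside `W` (`residueOverringLift`), whose trace on `K` is
`V ∩ K` or `W ∩ K`. [folklore] -/
theorem isRankOne_resField_of_minimal {K : Subfield Ω}
    (hne : V.comap (algebraMap K Ω) ≠ W.comap (algebraMap K Ω))
    (hmin : ∀ S : ValuationSubring K, V.comap (algebraMap K Ω) ≤ S →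
      S ≤ W.comap (algebraMap K Ω) → S = V.comap (algebraMap K Ω) ∨ S = W.comap (algebraMap K Ω)) :
    IsRankOne (residueValuationSubring V W hVW) (resField W K) := by
  set V₁ := residueValuationSubring V W hVW with hV₁
  set K₁ : Subfield (ResidueField W) := resField W K with hK₁
  set O₁ : ValuationSubring K₁ := V₁.comap (algebraMap K₁ (ResidueField W)) with hO₁
  have hVWK : V.comap (algebraMap K Ω) ≤ W.comap (algebraMap K Ω) := fun z hz => hVW hz
  -- membership in `O₁` for residues of elements of `W ∩ K`
  have hmemO₁ : ∀ (a : W) (haK : (a : Ω) ∈ K),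
      (⟨residue W a, residue_mem_resField W a haK⟩ : K₁) ∈ O₁ ↔ (a : Ω) ∈ V := fun a haK => by
    rw [hO₁, ValuationSubring.mem_comap]
    exact residue_mem_residueValuationSubring_iff V W hVW a
  refine ⟨fun htop => hne (le_antisymm hVWK fun z hzW => ?_), fun S₁ hS₁ => ?_⟩
  · -- `O₁ = K₁` forces `W ∩ K ⊆ V`
    have hzW' : ((z : K) : Ω) ∈ W := ValuationSubring.mem_comap.mp hzW
    have hz : (⟨residue W ⟨(z : Ω), hzW'⟩, residue_mem_resField W ⟨(z : Ω), hzW'⟩ z.2⟩ : K₁) ∈ O₁ := by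
      have htop' : O₁ = ⊤ := htop
      rw [htop']
      exact ValuationSubring.mem_top _
    exact ValuationSubring.mem_comap.mpr ((hmemO₁ ⟨(z : Ω), hzW'⟩ z.2).mp hz)
  · -- extend `S₁` to `ΩW`, lift to `Ω`, restrict to `K`
    set T₁ : ValuationSubring (ResidueField W) := comapHull V₁ (algebraMap K₁ (ResidueField W)) S₁
      with hT₁
    have hV₁T₁ : V₁ ≤ T₁ := le_comapHull V₁ _ S₁
    have hT₁S₁ : T₁.comap (algebraMap K₁ (ResidueField W)) = S₁ := comap_comapHull V₁ _ S₁ hS₁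
    set T : ValuationSubring Ω := residueOverringLift W T₁ with hT
    have hVT : V ≤ T := le_residueOverringLift V W hVW T₁ hV₁T₁
    have hTW : T ≤ W := residueOverringLift_le W T₁
    have hmemT : ∀ (a : W), (a : Ω) ∈ T ↔ residue W a ∈ T₁ := fun a => by
      rw [hT, mem_residueOverringLift_iff]
      exact ⟨fun ⟨_, h'⟩ => h', fun h' => ⟨a.2, h'⟩⟩
    have hmemS₁ : ∀ (a : W) (haK : (a : Ω) ∈ K),
        (⟨residue W a, residue_mem_resField W a haK⟩ : K₁) ∈ S₁ ↔ (a : Ω) ∈ T := fun a haK => by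
      rw [hmemT, ← hT₁S₁, ValuationSubring.mem_comap]
      rfl
    rcases hmin (T.comap (algebraMap K Ω)) (fun z hz => hVT hz) (fun z hz => hTW hz) with hTK | hTK
    · -- `T ∩ K = V ∩ K`: then `S₁ = O₁`
      left
      refine le_antisymm (fun r hr => ?_) hS₁
      obtain ⟨a, haK, ha⟩ := (mem_resField_iff W K (r : ResidueField W)).mp r.2
      have hr' : r = ⟨residue W a, residue_mem_resField W a haK⟩ := Subtype.ext ha.symm
      rw [hr'] at hr ⊢
      have haT : (a : Ω) ∈ T := (hmemS₁ a haK).mp hr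
      have haV : (⟨(a : Ω), haK⟩ : K) ∈ V.comap (algebraMap K Ω) := by
        rw [← hTK]
        exact ValuationSubring.mem_comap.mpr haT
      exact (hmemO₁ a haK).mpr (ValuationSubring.mem_comap.mp haV)
    · -- `T ∩ K = W ∩ K`: then `S₁ = K₁`
      right
      refine eq_top_iff.mpr fun r _ => ?_
      obtain ⟨a, haK, ha⟩ := (mem_resField_iff W K (r : ResidueField W)).mp r.2
      have hr' : r = ⟨residue W a, residue_mem_resField W a haK⟩ := Subtype.ext ha.symm
      rw [hr']
      have haW : (⟨(a : Ω), haK⟩ : K) ∈ W.comap (algebraMap K Ω) :=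
        ValuationSubring.mem_comap.mpr a.2
      rw [← hTK] at haW
      exact (hmemS₁ a haK).mpr (ValuationSubring.mem_comap.mp haW)

end Residue

end Literature.AlgebraicGeometry.Resolution
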